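import Summits.NavierStokesRegularity.NavierStokesRegularity.Theorems.HubbleDynamoNoSelfExcitedDynamoStubLimitClosed
import Summits.NavierStokesRegularity.NavierStokesRegularity.Theorems.HubbleDynamoNoSelfExcitedDynamoStubAlphaLimit
import Mathlib.Topology.UniformSpace.CompactConvergence
import Mathlib.Topology.Sequences
import Mathlib.Order.Zorn
import HarnessLib

/-!
# Crux `NoSelfExcitedDynamo` (stmt-NavierStokesRegularity-1934), line `registered`: a past amplitude
  floor is realised by a RECURRENT eternal profile-class solution

Theorems file (lands `--supports stmt-NavierStokesRegularity-1934`; registered sub-goal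
`stub_recurrentProfile`). Let `(U, P)` be an ETERNAL classical solution of Leray's backward system
`∂ₛU + ½U + ½(y·∇)U + (U·∇)U + ∇P = ΔU`, `div U = 0` on `ℝ × ℝ³`
(`IsBackwardLeraySolutionOn univ 1 U P`) in the uniform profile class
`(1 + ‖y‖)^{k+1}‖DᵏU(s, y)‖ ≤ K_k`, keeping an amplitude floor `δ > 0` on a past half-line
(`∀ s ≤ S, ∃ y, δ ≤ ‖U(s, y)‖`). Then some eternal profile-class solution `(W, Q)` keeps the floor
`δ` at EVERY similarity time and is moreover RECURRENT along integer similarity times: for every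
`ε > 0`, radius `R` and threshold `N` there is `n ≥ N` with `‖W(s + n, y) − W(s, y)‖ < ε` on
`[−R, R] × B̄(0, R)` (`stub_recurrentProfile`).

Proof (Birkhoff recurrence in a compact shift-invariant set of fields).
1. `stub_alphaLimit` gives an eternal profile-class `(W₀, Q₀)` with the floor at every time; let
   `K₀` be its `k = 0` profile constant, `(1 + ‖y‖)‖W₀(s, y)‖ ≤ K₀`.
2. In `X = C(ℝ × ℝ³, ℝ³)` with the compact-open topology (= topology of compact convergence,
   `ContinuousMap.compactConvergenceUniformSpace`; pseudo-metrisable since `ℝ × ℝ³` is σ-compact and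
   locally compact, Hausdorff) consider the set `K` of uncurried eternal profile-class solutions
   with `k = 0` constant `K₀` and floor `δ` at every time. It contains
   `W₀`, is invariant under the unit shift `T F (s, y) = F (s + 1, y)` (Leray's system is
   autonomous, `alphaLimit_translate`; `T` is continuous: precomposition,
   `ContinuousMap.continuous_precomp`), and is sequentially compact by the sibling stub
   `stub_limitClosed` (uniform convergence on the boxes `[−R, R] × B̄(0, R)` is convergence in `X`,
   every compact being inside a box), hence compact (`IsSeqCompact.isCompact`).
3. Birkhoff: a continuous self-map of a nonempty compact set in a Hausdorff space has a recurrent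
   point (`exists_recurrent_point`: Zorn and the finite-intersection property give a minimal
   nonempty closed invariant subset `M`, `exists_minimal_invariant`, and for `x ∈ M` the closed
   invariant set `closure {Tⁿ⁺ᴺx}` is all of `M`, so contains `x`).
4. Unpacking the basic compact-convergence neighbourhoods
   (`ContinuousMap.hasBasis_compactConvergenceUniformity`) of the recurrent point gives the claim.

## References

* G. D. Birkhoff, *Dynamical systems*, AMS Colloquium Publ. IX (1927), Ch. VII §1–2 (recurrent
  motions in compact invariant sets).
* G. Koch, N. Nadirashvili, G. Seregin, V. Šverák, *Liouville theorems for the Navier–Stokes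
  equations and applications*, Acta Math. 203 (2009) 83–105 = arXiv:0709.3599, Lemma 6.1.
  [KochNadirashviliSereginSverak2009]
-/

noncomputable section

-- the mandated stub namespace repeats `NavierStokesRegularity` (tree precedent for this crux's stubs)
set_option linter.dupNamespace false

namespace Summit.NavierStokesRegularity.NavierStokesRegularity.Theorems.NoSelfExcitedDynamo.Registered

open Set MeasureTheory Filter Topology Function Metric
open scoped ContDiff
open Literature.Analysis
open Literature.Analysis.FluidPDE

/-! ### Birkhoff's recurrence theorem (topological dynamics, Mathlib only) -/

/-- **Existence of a minimal closed invariant subset** (Zorn + the finite-intersection property of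
compact sets): a continuous map `T` with `T(K) ⊆ K`, `K` nonempty compact in a Hausdorff space, has a
nonempty closed `T`-invariant `M ⊆ K` all of whose nonempty closed `T`-invariant subsets equal `M`. -/
theorem exists_minimal_invariant {X : Type*} [TopologicalSpace X] [T2Space X] {K : Set X}
    (hK : IsCompact K) (hne : K.Nonempty) {T : X → X} (hinv : MapsTo T K K) :
    ∃ M ⊆ K, M.Nonempty ∧ IsClosed M ∧ MapsTo T M M ∧
      ∀ A ⊆ M, A.Nonempty → IsClosed A → MapsTo T A A → A = M := by
  classical
  set S : Set (Set X) := {A | A ⊆ K ∧ A.Nonempty ∧ IsClosed A ∧ MapsTo T A A} with hS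
  have hKS : K ∈ S := ⟨Subset.rfl, hne, hK.isClosed, hinv⟩
  -- every chain in `S` has a lower bound in `S`: its intersection
  have hchain : ∀ c ⊆ S, IsChain (· ⊆ ·) c → c.Nonempty → ∃ lb ∈ S, ∀ A ∈ c, lb ⊆ A := by
    intro c hcS hc hcne
    refine ⟨⋂₀ c, ⟨?_, ?_, ?_, ?_⟩, fun A hA => sInter_subset_of_mem hA⟩
    · obtain ⟨A, hA⟩ := hcne
      exact (sInter_subset_of_mem hA).trans (hcS hA).1
    · -- finite intersection property inside the compact `K`
      haveI : Nonempty c := hcne.to_subtype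
      have hdir : Directed (· ⊇ ·) (fun A : c => (A : Set X)) := by
        rintro ⟨A, hA⟩ ⟨B, hB⟩
        rcases hc.total hA hB with hAB | hBA
        · exact ⟨⟨A, hA⟩, Subset.rfl, hAB⟩
        · exact ⟨⟨B, hB⟩, hBA, Subset.rfl⟩
      have key := IsCompact.nonempty_iInter_of_directed_nonempty_isCompact_isClosed
        (fun A : c => (A : Set X)) hdir (fun A => (hcS A.2).2.1)
        (fun A => hK.of_isClosed_subset (hcS A.2).2.2.1 (hcS A.2).1) fun A => (hcS A.2).2.2.1
      rwa [← sInter_eq_iInter] at key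
    · exact isClosed_sInter fun A hA => (hcS hA).2.2.1
    · intro x hx
      rw [mem_sInter] at hx ⊢
      exact fun A hA => (hcS hA).2.2.2 (hx A hA)
  obtain ⟨M, hMK, hmin⟩ := zorn_superset_nonempty S hchain K hKS
  -- `hMK : K ⊇ M`? zorn_superset_nonempty gives `M ∈ S`, `M ⊆ K`-type conclusions; unpack
  refine ⟨M, hmin.prop.1, hmin.prop.2.1, hmin.prop.2.2.1, hmin.prop.2.2.2, fun A hAM hAne hAc hAT => ?_⟩
  have hAS : A ∈ S := ⟨hAM.trans hmin.prop.1, hAne, hAc, hAT⟩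
  exact hmin.eq_of_subset hAS hAM

/-- **Birkhoff's recurrence theorem.** A continuous map `T` with `T(K) ⊆ K`, `K` nonempty compact in
a Hausdorff space, has a RECURRENT point `x ∈ K`: every neighbourhood of `x` is visited by `Tⁿx` for
arbitrarily large `n` (the orbit clusters at `x`). Proof: points of a minimal closed invariant set
`M` are recurrent, because `closure {Tⁿ⁺ᴺ x : n}` is a nonempty closed invariant subset of `M`. -/
theorem exists_recurrent_point {X : Type*} [TopologicalSpace X] [T2Space X] {K : Set X}
    (hK : IsCompact K) (hne : K.Nonempty) {T : X → X} (hT : Continuous T) (hinv : MapsTo T K K) :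
    ∃ x ∈ K, ∀ N : ℕ, ∀ U ∈ 𝓝 x, ∃ n, N ≤ n ∧ T^[n] x ∈ U := by
  obtain ⟨M, hMK, hMne, hMc, hMT, hmin⟩ := exists_minimal_invariant hK hne hinv
  obtain ⟨x, hx⟩ := hMne
  refine ⟨x, hMK hx, fun N U hU => ?_⟩
  -- the closed invariant set `closure {T^[n + N] x | n}` is all of `M`, hence contains `x`
  set A : Set X := closure (Set.range fun n : ℕ => T^[n + N] x) with hA
  have hiter : ∀ k : ℕ, T^[k] x ∈ M := fun k => by
    induction k with
    | zero => simpa using hx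
    | succ k ih => rw [Function.iterate_succ_apply']; exact hMT ih
  have hAM : A ⊆ M := closure_minimal (by rintro _ ⟨n, rfl⟩; exact hiter _) hMc
  have hAne : A.Nonempty := ⟨_, subset_closure ⟨0, rfl⟩⟩
  have hAT : MapsTo T A A := by
    have h1 : MapsTo T (Set.range fun n : ℕ => T^[n + N] x) (Set.range fun n : ℕ => T^[n + N] x) := by
      rintro _ ⟨n, rfl⟩
      refine ⟨n + 1, ?_⟩
      show T^[n + 1 + N] x = T (T^[n + N] x)
      rw [show n + 1 + N = (n + N) + 1 by ring, Function.iterate_succ_apply']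
    exact h1.closure hT
  have hAeq : A = M := hmin A hAM hAne isClosed_closure hAT
  have hxA : x ∈ A := by rw [hAeq]; exact hx
  rw [hA, mem_closure_iff_nhds] at hxA
  obtain ⟨_, hyU, ⟨n, rfl⟩⟩ := hxA U hU
  exact ⟨n + N, Nat.le_add_left N n, hyU⟩

/-! ### The space `C(ℝ × ℝ³, ℝ³)` of compact convergence: boxes, neighbourhoods, the unit shift -/

/-- **Every compact subset of `ℝ × ℝ³` lies in a box `[−R, R] × B̄(0, R)`** (compact sets are
bounded; the product norm is the max norm). -/
theorem recurrentProfile_exists_box_superset {Kc : Set (ℝ × EuclideanSpace ℝ (Fin 3))}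
    (hKc : IsCompact Kc) :
    ∃ R : ℝ, Kc ⊆ Icc (-R) R ×ˢ closedBall (0 : EuclideanSpace ℝ (Fin 3)) R := by
  obtain ⟨R, hR⟩ := hKc.isBounded.subset_closedBall (0 : ℝ × EuclideanSpace ℝ (Fin 3))
  refine ⟨R, fun z hz => ?_⟩
  have h := hR hz
  rw [mem_closedBall, dist_zero_right, Prod.norm_def] at h
  have h1 : ‖z.1‖ ≤ R := (le_max_left _ _).trans h
  have h2 : ‖z.2‖ ≤ R := (le_max_right _ _).trans h
  rw [Real.norm_eq_abs, abs_le] at h1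
  exact ⟨h1, mem_closedBall_zero_iff.2 h2⟩

/-- **Uniform convergence on all boxes is convergence in `C(ℝ × ℝ³, ℝ³)`** (compact-open topology =
topology of compact convergence, `ContinuousMap.tendsto_iff_forall_isCompact_tendstoUniformlyOn`;
every compact lies in a box). -/
theorem recurrentProfile_tendsto_of_boxes
    {G : ℕ → C(ℝ × EuclideanSpace ℝ (Fin 3), EuclideanSpace ℝ (Fin 3))}
    {g : C(ℝ × EuclideanSpace ℝ (Fin 3), EuclideanSpace ℝ (Fin 3))}
    (h : ∀ R : ℝ, TendstoUniformlyOn (fun j => ⇑(G j)) g atTop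
      (Icc (-R) R ×ˢ closedBall (0 : EuclideanSpace ℝ (Fin 3)) R)) :
    Tendsto G atTop (𝓝 g) := by
  rw [ContinuousMap.tendsto_iff_forall_isCompact_tendstoUniformlyOn]
  intro Kc hKc
  obtain ⟨R, hR⟩ := recurrentProfile_exists_box_superset hKc
  exact (h R).mono hR

/-- **Basic neighbourhoods of compact convergence**: the fields uniformly `ε`-close to `F` on the box
`[−R, R] × B̄(0, R)` form a neighbourhood of `F` in `C(ℝ × ℝ³, ℝ³)`
(`ContinuousMap.hasBasis_compactConvergenceUniformity`, `UniformSpace.ball_mem_nhds`). -/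
theorem recurrentProfile_box_mem_nhds
    (F : C(ℝ × EuclideanSpace ℝ (Fin 3), EuclideanSpace ℝ (Fin 3))) {ε : ℝ} (hε : 0 < ε) (R : ℝ) :
    {G : C(ℝ × EuclideanSpace ℝ (Fin 3), EuclideanSpace ℝ (Fin 3)) |
      ∀ z ∈ Icc (-R) R ×ˢ closedBall (0 : EuclideanSpace ℝ (Fin 3)) R, dist (F z) (G z) < ε} ∈ 𝓝 F := by
  have hKc : IsCompact (Icc (-R) R ×ˢ closedBall (0 : EuclideanSpace ℝ (Fin 3)) R) :=
    isCompact_Icc.prod (isCompact_closedBall 0 R)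
  have hV : {fg : C(ℝ × EuclideanSpace ℝ (Fin 3), EuclideanSpace ℝ (Fin 3)) ×
      C(ℝ × EuclideanSpace ℝ (Fin 3), EuclideanSpace ℝ (Fin 3)) |
        ∀ z ∈ Icc (-R) R ×ˢ closedBall (0 : EuclideanSpace ℝ (Fin 3)) R, (fg.1 z, fg.2 z) ∈
          {p : EuclideanSpace ℝ (Fin 3) × EuclideanSpace ℝ (Fin 3) | dist p.1 p.2 < ε}} ∈
      uniformity C(ℝ × EuclideanSpace ℝ (Fin 3), EuclideanSpace ℝ (Fin 3)) :=
    ContinuousMap.hasBasis_compactConvergenceUniformity.mem_of_mem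
      (i := (Icc (-R) R ×ˢ closedBall (0 : EuclideanSpace ℝ (Fin 3)) R,
        {p : EuclideanSpace ℝ (Fin 3) × EuclideanSpace ℝ (Fin 3) | dist p.1 p.2 < ε}))
      ⟨hKc, Metric.dist_mem_uniformity hε⟩
  exact UniformSpace.ball_mem_nhds F hV

/-- **Iterated shifts**: `(Tⁿ F)(s, y) = F(s + n, y)` for the precomposition `T F = F ∘ τ` with
the unit shift of similarity time `τ (s, y) = (s + 1, y)`. -/
theorem recurrentProfile_iterate_shift_apply
    (τ : C(ℝ × EuclideanSpace ℝ (Fin 3), ℝ × EuclideanSpace ℝ (Fin 3)))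
    (hτ : ∀ (s : ℝ) (y : EuclideanSpace ℝ (Fin 3)), τ (s, y) = (s + 1, y)) (n : ℕ)
    (F : C(ℝ × EuclideanSpace ℝ (Fin 3), EuclideanSpace ℝ (Fin 3))) (s : ℝ)
    (y : EuclideanSpace ℝ (Fin 3)) :
    ((fun G : C(ℝ × EuclideanSpace ℝ (Fin 3), EuclideanSpace ℝ (Fin 3)) => G.comp τ)^[n] F) (s, y) =
      F (s + n, y) := by
  induction n generalizing s with
  | zero => simp
  | succ n ih =>
    rw [Function.iterate_succ_apply', ContinuousMap.comp_apply, hτ, ih, Nat.cast_succ, add_assoc,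
      add_comm (1 : ℝ) (n : ℝ)]

/-! ### The compact shift-invariant set of eternal profile-class fields with a floor -/

/-- **Eternal solutions are jointly continuous** (they are jointly smooth on `univ × ℝ³`). -/
theorem recurrentProfile_continuous_uncurry
    {W : ℝ → EuclideanSpace ℝ (Fin 3) → EuclideanSpace ℝ (Fin 3)}
    {Q : ℝ → EuclideanSpace ℝ (Fin 3) → ℝ} (hW : IsBackwardLeraySolutionOn univ 1 W Q) :
    Continuous (uncurry W) := by
  rw [← continuousOn_univ, ← univ_prod_univ]
  exact hW.smooth_velocity.continuousOn

/-- **The recurrence set is shift-invariant.** Let `K ⊆ C(ℝ × ℝ³, ℝ³)` be the set of uncurried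
eternal classical solutions `W` of Leray's backward system in the uniform profile class with `k = 0`
constant `(1 + ‖y‖)‖W(s, y)‖ ≤ K₀` and the amplitude floor `δ` at every similarity time. Then `K` is
invariant under precomposition with the unit shift `τ (s, y) = (s + 1, y)`: Leray's system is
autonomous in `s` (`alphaLimit_translate`), and the bound, the profile class and the floor are
reindexed. -/
theorem recurrentProfile_mapsTo_shift {K₀ δ : ℝ}
    {K : Set C(ℝ × EuclideanSpace ℝ (Fin 3), EuclideanSpace ℝ (Fin 3))}
    (hK : ∀ F, F ∈ K ↔ ∃ (W : ℝ → EuclideanSpace ℝ (Fin 3) → EuclideanSpace ℝ (Fin 3))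
      (Q : ℝ → EuclideanSpace ℝ (Fin 3) → ℝ), IsBackwardLeraySolutionOn univ 1 W Q ∧
      (∀ s y, (1 + ‖y‖) * ‖W s y‖ ≤ K₀) ∧
      (∀ k : ℕ, ∃ K : ℝ, ∀ s y, (1 + ‖y‖) ^ (k + 1) * ‖iteratedFDeriv ℝ k (W s) y‖ ≤ K) ∧
      (∀ s, ∃ y, δ ≤ ‖W s y‖) ∧ ∀ s y, F (s, y) = W s y)
    (τ : C(ℝ × EuclideanSpace ℝ (Fin 3), ℝ × EuclideanSpace ℝ (Fin 3)))
    (hτ : ∀ (s : ℝ) (y : EuclideanSpace ℝ (Fin 3)), τ (s, y) = (s + 1, y)) :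
    MapsTo (fun G : C(ℝ × EuclideanSpace ℝ (Fin 3), EuclideanSpace ℝ (Fin 3)) => G.comp τ) K K := by
  intro F hF
  obtain ⟨W, Q, hW, hbd, hprof, hfl, hFW⟩ := (hK F).1 hF
  refine (hK _).2 ⟨fun s => W (s + 1), fun s => Q (s + 1), alphaLimit_translate hW 1,
    fun s y => hbd _ y, fun k => ?_, fun s => hfl _, fun s y => ?_⟩
  · obtain ⟨K', hK'⟩ := hprof k
    exact ⟨K', fun s y => hK' _ y⟩
  · show F (τ (s, y)) = W (s + 1) y
    rw [hτ]
    exact hFW _ y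

/-- **The recurrence set is sequentially compact** (`δ > 0`; `K` as in
`recurrentProfile_mapsTo_shift`): by the sibling stub `stub_limitClosed` a sequence in `K` has a
subsequence converging uniformly on every box `[−R, R] × B̄(0, R)` to a member of `K`, and uniform
convergence on boxes is convergence in `C(ℝ × ℝ³, ℝ³)` (`recurrentProfile_tendsto_of_boxes`). -/
theorem recurrentProfile_isSeqCompact {K₀ δ : ℝ}
    {K : Set C(ℝ × EuclideanSpace ℝ (Fin 3), EuclideanSpace ℝ (Fin 3))}
    (hK : ∀ F, F ∈ K ↔ ∃ (W : ℝ → EuclideanSpace ℝ (Fin 3) → EuclideanSpace ℝ (Fin 3))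
      (Q : ℝ → EuclideanSpace ℝ (Fin 3) → ℝ), IsBackwardLeraySolutionOn univ 1 W Q ∧
      (∀ s y, (1 + ‖y‖) * ‖W s y‖ ≤ K₀) ∧
      (∀ k : ℕ, ∃ K : ℝ, ∀ s y, (1 + ‖y‖) ^ (k + 1) * ‖iteratedFDeriv ℝ k (W s) y‖ ≤ K) ∧
      (∀ s, ∃ y, δ ≤ ‖W s y‖) ∧ ∀ s y, F (s, y) = W s y)
    (hδ : 0 < δ) : IsSeqCompact K := by
  intro F hF
  have hF' := fun n => (hK _).1 (hF n)
  choose Wn Qn hWn hbd hprof hfl hFW using hF'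
  obtain ⟨φ, W, Q, hφ, hW, hWbd, hWprof, hWfl, hconv⟩ :=
    stub_limitClosed K₀ δ Wn Qn hδ hWn hbd hfl
  refine ⟨⟨uncurry W, recurrentProfile_continuous_uncurry hW⟩,
    (hK _).2 ⟨W, Q, hW, hWbd, hWprof, hWfl, fun _ _ => rfl⟩, φ, hφ,
    recurrentProfile_tendsto_of_boxes fun R => ?_⟩
  have hfun : (fun j => ⇑((F ∘ φ) j)) = fun j => uncurry (Wn (φ j)) := by
    funext j
    funext z
    obtain ⟨s, y⟩ := z
    exact hFW (φ j) s y
  rw [hfun]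
  exact hconv R

/-! ### The registered stub -/

/-- **Stub `stub_recurrentProfile`** (Birkhoff recurrence for eternal profile flows). If an eternal
profile-class solution `(U, P)` of Leray's backward system keeps an amplitude floor `δ > 0` on a past
half-line, then some eternal profile-class `(W, Q)` keeps the floor at every similarity time AND is
RECURRENT along integer similarity times: for every `ε > 0`, radius `R` and `N` there is `n ≥ N`
with `‖W(s + n, y) − W(s, y)‖ < ε` on `[−R, R] × B̄(0, R)`. Proof: `stub_alphaLimit` realises the
floor at every time by some `W₀` with `k = 0` constant `K₀`; the set of uncurried eternal
profile-class fields with constant `K₀` and floor `δ` is a nonempty compact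
(`recurrentProfile_isSeqCompact`, via the sibling stub `stub_limitClosed`) subset of
`C(ℝ × ℝ³, ℝ³)` invariant under the unit time shift (`recurrentProfile_mapsTo_shift`), so it carries
a recurrent point (`exists_recurrent_point`), whose compact-convergence neighbourhoods
(`recurrentProfile_box_mem_nhds`) unpack to the stated estimate. -/
theorem stub_recurrentProfile :
    ∀ (U : ℝ → EuclideanSpace ℝ (Fin 3) → EuclideanSpace ℝ (Fin 3)) (P : ℝ → EuclideanSpace ℝ (Fin 3) → ℝ),
      IsBackwardLeraySolutionOn univ 1 U P →
      (∀ k : ℕ, ∃ K : ℝ, ∀ s y, (1 + ‖y‖) ^ (k + 1) * ‖iteratedFDeriv ℝ k (U s) y‖ ≤ K) →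
      ∀ (δ S : ℝ), 0 < δ → (∀ s ≤ S, ∃ y, δ ≤ ‖U s y‖) →
        ∃ (W : ℝ → EuclideanSpace ℝ (Fin 3) → EuclideanSpace ℝ (Fin 3)) (Q : ℝ → EuclideanSpace ℝ (Fin 3) → ℝ),
          IsBackwardLeraySolutionOn univ 1 W Q ∧
          (∀ k : ℕ, ∃ K : ℝ, ∀ s y, (1 + ‖y‖) ^ (k + 1) * ‖iteratedFDeriv ℝ k (W s) y‖ ≤ K) ∧
          (∀ s, ∃ y, δ ≤ ‖W s y‖) ∧
          ∀ ε : ℝ, 0 < ε → ∀ (R : ℝ) (N : ℕ), ∃ n : ℕ, N ≤ n ∧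
            ∀ s ∈ Icc (-R) R, ∀ y ∈ Metric.closedBall (0 : EuclideanSpace ℝ (Fin 3)) R,
              ‖W (s + n) y - W s y‖ < ε := by
  intro U P hL hprof δ S hδ hfloor
  -- an eternal profile-class solution with the floor at every time, and its `k = 0` constant
  obtain ⟨W₀, Q₀, hW₀, hW₀prof, hW₀fl⟩ := stub_alphaLimit U P hL hprof δ S hfloor
  obtain ⟨K₀, hK₀'⟩ := hW₀prof 0
  have hK₀ : ∀ s y, (1 + ‖y‖) * ‖W₀ s y‖ ≤ K₀ := fun s y => by
    have h := hK₀' s y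
    rwa [zero_add, pow_one, norm_iteratedFDeriv_zero] at h
  -- the recurrence set `K ⊆ C(ℝ × ℝ³, ℝ³)` and the unit shift `τ`
  set K : Set C(ℝ × EuclideanSpace ℝ (Fin 3), EuclideanSpace ℝ (Fin 3)) :=
    {F | ∃ (W : ℝ → EuclideanSpace ℝ (Fin 3) → EuclideanSpace ℝ (Fin 3))
      (Q : ℝ → EuclideanSpace ℝ (Fin 3) → ℝ), IsBackwardLeraySolutionOn univ 1 W Q ∧
      (∀ s y, (1 + ‖y‖) * ‖W s y‖ ≤ K₀) ∧
      (∀ k : ℕ, ∃ K : ℝ, ∀ s y, (1 + ‖y‖) ^ (k + 1) * ‖iteratedFDeriv ℝ k (W s) y‖ ≤ K) ∧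
      (∀ s, ∃ y, δ ≤ ‖W s y‖) ∧ ∀ s y, F (s, y) = W s y}
  have hK : ∀ F, F ∈ K ↔ ∃ (W : ℝ → EuclideanSpace ℝ (Fin 3) → EuclideanSpace ℝ (Fin 3))
      (Q : ℝ → EuclideanSpace ℝ (Fin 3) → ℝ), IsBackwardLeraySolutionOn univ 1 W Q ∧
      (∀ s y, (1 + ‖y‖) * ‖W s y‖ ≤ K₀) ∧
      (∀ k : ℕ, ∃ K : ℝ, ∀ s y, (1 + ‖y‖) ^ (k + 1) * ‖iteratedFDeriv ℝ k (W s) y‖ ≤ K) ∧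
      (∀ s, ∃ y, δ ≤ ‖W s y‖) ∧ ∀ s y, F (s, y) = W s y := fun F => Iff.rfl
  obtain ⟨τ, hτ⟩ : ∃ τ : C(ℝ × EuclideanSpace ℝ (Fin 3), ℝ × EuclideanSpace ℝ (Fin 3)),
      ∀ (s : ℝ) (y : EuclideanSpace ℝ (Fin 3)), τ (s, y) = (s + 1, y) :=
    ⟨⟨fun z => (z.1 + 1, z.2), (continuous_fst.add continuous_const).prodMk continuous_snd⟩,
      fun _ _ => rfl⟩
  -- Birkhoff recurrence in the nonempty compact shift-invariant set `K`
  have hne : K.Nonempty :=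
    ⟨⟨uncurry W₀, recurrentProfile_continuous_uncurry hW₀⟩,
      (hK _).2 ⟨W₀, Q₀, hW₀, hK₀, hW₀prof, hW₀fl, fun _ _ => rfl⟩⟩
  have hKc : IsCompact K := (recurrentProfile_isSeqCompact hK hδ).isCompact
  obtain ⟨F, hF, hrec⟩ := exists_recurrent_point hKc hne (ContinuousMap.continuous_precomp τ)
    (recurrentProfile_mapsTo_shift hK τ hτ)
  obtain ⟨W, Q, hW, -, hWprof, hWfl, hFW⟩ := (hK F).1 hF
  refine ⟨W, Q, hW, hWprof, hWfl, fun ε hε R N => ?_⟩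
  obtain ⟨n, hNn, hn⟩ := hrec N _ (recurrentProfile_box_mem_nhds F hε R)
  refine ⟨n, hNn, fun s hs y hy => ?_⟩
  have h : dist (F (s, y)) (((fun G : C(ℝ × EuclideanSpace ℝ (Fin 3), EuclideanSpace ℝ (Fin 3)) =>
      G.comp τ)^[n] F) (s, y)) < ε := hn (s, y) ⟨hs, hy⟩
  rw [recurrentProfile_iterate_shift_apply τ hτ, hFW, hFW, dist_comm, dist_eq_norm] at h
  exact h

end Summit.NavierStokesRegularity.NavierStokesRegularity.Theorems.NoSelfExcitedDynamo.Registered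

end
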